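/-
Copyright (c) 2026 the pub-hodgecm-mathlib formalisation cell (harness21).  Prover seat hodgecm-mathlib-R90-C131-p02 (g0) (R90-TF S4 hand lent to L1
by CHAIR VALVE WORD W4), Track B «K2-LIT», hLiu418 = `stmt-HodgeConjecture-24832`; K1-a♮ line lead K2E5-p16 (g8) WORD #11 (α) (the arch letters; K2E4-p10's
TERM PACKAGE decay letter `hAcb` needs GROWTH of the continued letter in the index).  THEOREMS ONLY (no `def`, no instance, no notation, no named-fact
hypothesis, no `sorry`); lane `--supports stmt-HodgeConjecture-24832 --as helper`.
-/
import Summits.HodgeConjecture.HodgeConjecture.Theorems.K2LiuHermTwoEtaRankOneLetter   -- ★ ED. 3a: `norm_jIntegrand`, `integrableOn_exp_mul_rpow`, `integrableOn_jIntegrand`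
import Mathlib.Analysis.SpecialFunctions.Gamma.Basic
import HarnessLib

/-!
# Crux `HLiu418`, (K1a-3-arch) GROWTH LETTER: `‖J_{p,t}(α,β)‖ ≤ 2^{a}·(Γ(a+b+1)p^{−(a+b+1)} + (2t)^{a}Γ(b+1)p^{−(b+1)})` (`a = re α − 2 ≥ 0`) and
# `‖J_{p,t}(α,β)‖ ≤ (2t)^{a}Γ(b+1)p^{−(b+1)}` (`a ≤ 0`), `b = re β − 2 > −1` — polynomial growth of the rank-one confluent letter in the index size `t`

Cell `hodgecm-mathlib`, crux item hLiu418 = `stmt-HodgeConjecture-24832` (helper lane, count-neutral).  The continued scalar-type arch letter is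
EXPLICIT (★ p863574): `… · (π/p)e^{−pπt}(1/q′)^{2s}Γ(2s) · Φ_N(1+k/2, 1−k/2, p, s)` with `Φ_N` a finite combination of letters
`Γ(·)⁻¹J_{p,πt}(α′, β′)` (★ p863550 (c)); the TERM PACKAGE's decay binder (K2E4-p10, `‖Ac‖ ≤ C·H^a·e^{−bH^{−a′}τ}(1+τ)^N`) therefore needs the
growth of `J_{p,t}(α,β) = ∫₀^∞ e^{−pr}(r+2t)^{α−2}r^{β−2}dr` in `t` with explicit constants in `p`: this file.
* §1 `add_rpow_le_two_rpow_mul` (`(x+y)^a ≤ 2^a(x^a + y^a)`, `a ≥ 0`); §2 **`norm_jIntegral_le_of_nonneg`** (`a ≥ 0`), **`norm_jIntegral_le_of_nonpos`** (`a ≤ 0`).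

HONEST LABEL: analytic letters; closes no socket.  HC_CM is proved only modulo the 7 printed citations (2 remaining named inputs: hLiu418 =
`stmt-HodgeConjecture-24832`, h413 = `stmt-HodgeConjecture-24833`) until rung 0 closes.  REL ≠ ★ ≠ BUILT.

## References
* [Shimura1982] G. Shimura, *Confluent hypergeometric functions on tube domains*, Math. Ann. 260 (1982), §3 (3.6)–(3.8), §4 Thm. 4.2.
* [Shimura1997] G. Shimura, *Euler Products and Eisenstein Series*, CBMS 93 (1997), §16.4, §18.5.
-/

set_option autoImplicit false
set_option linter.dupNamespace false

noncomputable section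

open Complex MeasureTheory Set Filter Real

namespace Summit.HodgeConjecture.HodgeConjecture.Cruxes.HLiu418.K2LiuHermTwoEtaRankOneGrowth

open Summit.HodgeConjecture.HodgeConjecture.Cruxes.HLiu418.K2LiuHermTwoEtaRankOneLetter

/-! ## §1 An elementary letter -/

/-- `(x + y)^a ≤ 2^a (x^a + y^a)` for `x, y ≥ 0`, `a ≥ 0`. [folklore] -/
theorem add_rpow_le_two_rpow_mul {x y a : ℝ} (hx : 0 ≤ x) (hy : 0 ≤ y) (ha : 0 ≤ a) : (x + y) ^ a ≤ (2 : ℝ) ^ a * (x ^ a + y ^ a) := by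
  have hxa : 0 ≤ x ^ a := Real.rpow_nonneg hx _
  have hya : 0 ≤ y ^ a := Real.rpow_nonneg hy _
  have h2 : 0 ≤ (2 : ℝ) ^ a := Real.rpow_nonneg (by norm_num) _
  rcases le_total x y with hxy | hxy
  · have h1 : (x + y) ^ a ≤ (2 * y) ^ a := Real.rpow_le_rpow (by positivity) (by linarith) ha
    rw [Real.mul_rpow (by norm_num) hy] at h1
    nlinarith
  · have h1 : (x + y) ^ a ≤ (2 * x) ^ a := Real.rpow_le_rpow (by positivity) (by linarith) ha
    rw [Real.mul_rpow (by norm_num) hx] at h1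
    nlinarith

/-- The Gamma integral in the shape used here: `∫₀^∞ e^{−pr} r^c dr = (1/p)^{c+1} Γ(c+1)` (`p > 0`, `c > −1`). [folklore] -/
theorem integral_exp_mul_rpow {p : ℝ} (hp : 0 < p) {c : ℝ} (hc : -1 < c) :
    ∫ r in Ioi (0 : ℝ), Real.exp (-(p * r)) * r ^ c = (1 / p) ^ (c + 1) * Real.Gamma (c + 1) := by
  have h := Real.integral_rpow_mul_exp_neg_mul_Ioi (a := c + 1) (r := p) (by linarith) hp
  rw [add_sub_cancel_right] at h
  rw [← h]
  refine integral_congr_ae (Eventually.of_forall fun r => ?_)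
  simp only [mul_comm]

/-! ## §2 The growth of `J_{p,t}(α, β)` in `t` -/

/-- **GROWTH OF THE RANK-ONE LETTER, `re α ≥ 2`**: for `p, t > 0`, `a := re α − 2 ≥ 0`, `b := re β − 2 > −1`,
`‖∫₀^∞ e^{−pr}(r+2t)^{α−2}r^{β−2}dr‖ ≤ 2^{a}·((1/p)^{a+b+1}Γ(a+b+1) + (2t)^{a}·(1/p)^{b+1}Γ(b+1))` — polynomial of degree `a` in the index size `t`.
[Shimura1982, §3 (3.6)–(3.8)] -/
theorem norm_jIntegral_le_of_nonneg {p t : ℝ} (hp : 0 < p) (ht : 0 < t) {α β : ℂ} (ha : 0 ≤ (α - 2).re) (hb : -1 < (β - 2).re) :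
    ‖∫ r in Ioi (0 : ℝ), cexp (-((p * r : ℝ) : ℂ)) * ((((r + 2 * t : ℝ)) : ℂ) ^ (α - 2) * ((r : ℝ) : ℂ) ^ (β - 2))‖ ≤
      (2 : ℝ) ^ (α - 2).re * ((1 / p) ^ ((α - 2).re + (β - 2).re + 1) * Real.Gamma ((α - 2).re + (β - 2).re + 1) +
        (2 * t) ^ (α - 2).re * ((1 / p) ^ ((β - 2).re + 1) * Real.Gamma ((β - 2).re + 1))) := by
  set a : ℝ := (α - 2).re with hadef
  set b : ℝ := (β - 2).re with hbdef
  have hab : -1 < a + b := by linarith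
  -- the majorant `g r = 2^a (e^{−pr} r^{a+b} + (2t)^a e^{−pr} r^b)`
  have hI1 : IntegrableOn (fun r : ℝ => Real.exp (-(p * r)) * r ^ (a + b)) (Ioi 0) := integrableOn_exp_mul_rpow hp hab
  have hI2 : IntegrableOn (fun r : ℝ => Real.exp (-(p * r)) * r ^ b) (Ioi 0) := integrableOn_exp_mul_rpow hp hb
  have hg : IntegrableOn (fun r : ℝ => (2 : ℝ) ^ a * (Real.exp (-(p * r)) * r ^ (a + b) + (2 * t) ^ a * (Real.exp (-(p * r)) * r ^ b))) (Ioi 0) :=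
    (hI1.add (hI2.const_mul _)).const_mul _
  have hle : ∀ᵐ r ∂(volume.restrict (Ioi (0 : ℝ))), ‖cexp (-((p * r : ℝ) : ℂ)) * ((((r + 2 * t : ℝ)) : ℂ) ^ (α - 2) * ((r : ℝ) : ℂ) ^ (β - 2))‖ ≤
      (2 : ℝ) ^ a * (Real.exp (-(p * r)) * r ^ (a + b) + (2 * t) ^ a * (Real.exp (-(p * r)) * r ^ b)) := by
    refine (ae_restrict_iff' measurableSet_Ioi).2 (Eventually.of_forall fun r hr => ?_)
    have hr' : (0 : ℝ) < r := hr
    rw [norm_jIntegrand ht (α - 2) (β - 2) hr']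
    have he : 0 < Real.exp (-(p * r)) := Real.exp_pos _
    have hrb : 0 ≤ r ^ b := Real.rpow_nonneg hr'.le _
    have hsplit : (r + 2 * t) ^ a ≤ (2 : ℝ) ^ a * (r ^ a + (2 * t) ^ a) := add_rpow_le_two_rpow_mul hr'.le (by positivity) ha
    have hra : r ^ a * r ^ b = r ^ (a + b) := by rw [← Real.rpow_add hr']
    calc Real.exp (-(p * r)) * ((r + 2 * t) ^ a * r ^ b)
        ≤ Real.exp (-(p * r)) * ((2 : ℝ) ^ a * (r ^ a + (2 * t) ^ a) * r ^ b) :=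
          mul_le_mul_of_nonneg_left (mul_le_mul_of_nonneg_right hsplit hrb) he.le
      _ = (2 : ℝ) ^ a * (Real.exp (-(p * r)) * (r ^ a * r ^ b) + (2 * t) ^ a * (Real.exp (-(p * r)) * r ^ b)) := by ring
      _ = (2 : ℝ) ^ a * (Real.exp (-(p * r)) * r ^ (a + b) + (2 * t) ^ a * (Real.exp (-(p * r)) * r ^ b)) := by rw [hra]
  refine (norm_integral_le_of_norm_le hg hle).trans (le_of_eq ?_)
  rw [integral_const_mul, integral_add hI1 (hI2.const_mul _), integral_const_mul, integral_exp_mul_rpow hp hab, integral_exp_mul_rpow hp hb]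

/-- **GROWTH OF THE RANK-ONE LETTER, `re α ≤ 2`**: for `p, t > 0`, `a := re α − 2 ≤ 0`, `b := re β − 2 > −1`,
`‖∫₀^∞ e^{−pr}(r+2t)^{α−2}r^{β−2}dr‖ ≤ (2t)^{a}·(1/p)^{b+1}Γ(b+1)` (the base `r + 2t ≥ 2t` and `a ≤ 0`). [Shimura1982, §3 (3.6)–(3.8)] -/
theorem norm_jIntegral_le_of_nonpos {p t : ℝ} (hp : 0 < p) (ht : 0 < t) {α β : ℂ} (ha : (α - 2).re ≤ 0) (hb : -1 < (β - 2).re) :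
    ‖∫ r in Ioi (0 : ℝ), cexp (-((p * r : ℝ) : ℂ)) * ((((r + 2 * t : ℝ)) : ℂ) ^ (α - 2) * ((r : ℝ) : ℂ) ^ (β - 2))‖ ≤
      (2 * t) ^ (α - 2).re * ((1 / p) ^ ((β - 2).re + 1) * Real.Gamma ((β - 2).re + 1)) := by
  set a : ℝ := (α - 2).re with hadef
  set b : ℝ := (β - 2).re with hbdef
  have hI2 : IntegrableOn (fun r : ℝ => Real.exp (-(p * r)) * r ^ b) (Ioi 0) := integrableOn_exp_mul_rpow hp hb
  have hg : IntegrableOn (fun r : ℝ => (2 * t) ^ a * (Real.exp (-(p * r)) * r ^ b)) (Ioi 0) := hI2.const_mul _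
  have hle : ∀ᵐ r ∂(volume.restrict (Ioi (0 : ℝ))), ‖cexp (-((p * r : ℝ) : ℂ)) * ((((r + 2 * t : ℝ)) : ℂ) ^ (α - 2) * ((r : ℝ) : ℂ) ^ (β - 2))‖ ≤
      (2 * t) ^ a * (Real.exp (-(p * r)) * r ^ b) := by
    refine (ae_restrict_iff' measurableSet_Ioi).2 (Eventually.of_forall fun r hr => ?_)
    have hr' : (0 : ℝ) < r := hr
    rw [norm_jIntegrand ht (α - 2) (β - 2) hr']
    have he : 0 < Real.exp (-(p * r)) := Real.exp_pos _
    have hrb : 0 ≤ r ^ b := Real.rpow_nonneg hr'.le _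
    have hbase : (r + 2 * t) ^ a ≤ (2 * t) ^ a := Real.rpow_le_rpow_of_nonpos (by positivity) (by linarith) ha
    calc Real.exp (-(p * r)) * ((r + 2 * t) ^ a * r ^ b)
        ≤ Real.exp (-(p * r)) * ((2 * t) ^ a * r ^ b) := mul_le_mul_of_nonneg_left (mul_le_mul_of_nonneg_right hbase hrb) he.le
      _ = (2 * t) ^ a * (Real.exp (-(p * r)) * r ^ b) := by ring
  refine (norm_integral_le_of_norm_le hg hle).trans (le_of_eq ?_)
  rw [integral_const_mul, integral_exp_mul_rpow hp hb]

end Summit.HodgeConjecture.HodgeConjecture.Cruxes.HLiu418.K2LiuHermTwoEtaRankOneGrowth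

end
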